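import Summits.ResolutionOfSingularities.ResolutionOfSingularities.Theorems.FrobeniusClosingSteerTwoBasisDecompositionB
import Summits.ResolutionOfSingularities.ResolutionOfSingularities.Theorems.FrobeniusClosingSteerGeomChartResidueImperfect
import Literature.AlgebraicGeometry.Resolution.AdicCompletionRegular
import HarnessLib

/-!
# Crux `Steer` (stmt-ResolutionOfSingularities-16345), chain W4.1, hGW3 assembly: the FINITE 2-BASIS of the residue field of a GEOMETRIC CHART, and its
# dual 2-frame on the residue field of the completion (the supplies `hBS` / `hBhat` of `GeomAssembly.geomChain_false_of_pieces`)

OURS (campaign `res-hironaka`, rung L ★L-G4, slot W4.1; seat res-L0-w41-stub-2 g6; `hGW3-ASSEMBLY-MAP.md` d0970ee959ebaf4a §2; RULING 251 (c)). Theses-free,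
definition-free. A geometric chart `S = A_Q ⊂ L` (`A` a finitely generated subalgebra over a PERFECT field `k` of characteristic `2`, `Q` prime) has
`κ(S) ≅ κ(Q)` (`GeomChain.nonempty_residueField_ringEquiv`), essentially of finite type over `k`, hence carries a FINITE 2-BASIS with DUAL derivations
(res-D-lib-1's K-GG5 `TwoBasis.exists_twoBasis_dual_derivations`); both transport along ring isomorphisms, in particular to `κ(Ŝ)`
(`AdicCompletion.residueField_map_bijective`). [cite: Matsumura1987, Thm. 26.5] [folklore]

* `GeomTwoBasis.isTwoBasis_map_ringEquiv` — a 2-basis maps to a 2-basis under a ring isomorphism;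
* `GeomTwoBasis.exists_derivation_map_ringEquiv` — a derivation transports along a ring isomorphism (`D′ (e x) = e (D x)`);
* `GeomTwoBasis.exists_twoBasis_residueField_of_chart` — **hBS**; `GeomTwoBasis.exists_pFrame_completion_of_chart` — **hBhat**.
-/

noncomputable section

set_option linter.dupNamespace false

open IsLocalRing
open Literature.AlgebraicGeometry.Resolution
open Summit.ResolutionOfSingularities.ResolutionOfSingularities.Theorems.SwitchingDichotomy

namespace Summit.ResolutionOfSingularities.ResolutionOfSingularities.Theorems.SwitchingDichotomy.GeomTwoBasis

/-! ## Transport along ring isomorphisms -/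

/-- A finite 2-basis is carried to a finite 2-basis by a ring isomorphism. -/
theorem isTwoBasis_map_ringEquiv {F F' : Type} [Field F] [Field F'] (e : F ≃+* F') {r : ℕ} {lam : Fin r → F}
    (hB : TwoBasis.IsTwoBasis lam) : TwoBasis.IsTwoBasis (fun i => e (lam i)) := by
  classical
  have hpow : ∀ (ε : Fin r → Fin 2), TwoBasis.lamPow (fun i => e (lam i)) ε = e (TwoBasis.lamPow lam ε) := fun ε => by
    unfold TwoBasis.lamPow
    rw [map_prod]
    simp_rw [map_pow]
  have hsum : ∀ b : (Fin r → Fin 2) → F,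
      e (∑ ε, TwoBasis.lamPow lam ε * b ε ^ 2) = ∑ ε, TwoBasis.lamPow (fun i => e (lam i)) ε * (e (b ε)) ^ 2 := fun b => by
    rw [map_sum]
    refine Finset.sum_congr rfl fun ε _ => ?_
    rw [map_mul, map_pow, hpow]
  intro a'
  obtain ⟨b, hb, huniq⟩ := hB (e.symm a')
  refine ⟨fun ε => e (b ε), ?_, fun b' hb' => ?_⟩
  · change a' = ∑ ε, TwoBasis.lamPow (fun i => e (lam i)) ε * (e (b ε)) ^ 2
    rw [← hsum, ← hb, RingEquiv.apply_symm_apply]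
  · have h := huniq (fun ε => e.symm (b' ε)) (by
      apply e.injective
      rw [RingEquiv.apply_symm_apply, hsum]
      simp_rw [RingEquiv.apply_symm_apply]
      exact hb')
    funext ε
    rw [← h, RingEquiv.apply_symm_apply]

/-- A derivation transports along a ring isomorphism: `D′ := e ∘ D ∘ e⁻¹` is a `ℤ`-derivation of `F′` with `D′ (e x) = e (D x)`. -/
theorem exists_derivation_map_ringEquiv {F F' : Type} [Field F] [Field F'] (e : F ≃+* F') {A : Type} [CommRing A] [Algebra A F]
    (D : Derivation A F F) : ∃ D' : Derivation ℤ F' F', ∀ x, D' (e x) = e (D x) := by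
  refine ⟨{ toFun := fun y => e (D (e.symm y))
            map_add' := fun y z => by rw [map_add, map_add, map_add]
            map_smul' := fun n y => by
              change e (D (e.symm (n • y))) = n • e (D (e.symm y))
              rw [map_zsmul, map_zsmul, map_zsmul]
            map_one_eq_zero' := by
              change e (D (e.symm 1)) = 0
              rw [map_one, Derivation.map_one_eq_zero, map_zero]
            leibniz' := fun y z => by
              change e (D (e.symm (y * z))) = y • e (D (e.symm z)) + z • e (D (e.symm y))
              rw [map_mul, Derivation.leibniz, map_add, smul_eq_mul, smul_eq_mul, map_mul, map_mul, RingEquiv.apply_symm_apply,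
                RingEquiv.apply_symm_apply, smul_eq_mul, smul_eq_mul] }, fun x => ?_⟩
  change e (D (e.symm (e x))) = e (D x)
  rw [RingEquiv.symm_apply_apply]

/-! ## The supplies of the hGW3 assembler -/

/-- **hBS — the residue field of a geometric chart has a finite 2-basis.** [cite: Matsumura1987, Thm. 26.5] -/
theorem exists_twoBasis_residueField_of_chart (k L : Type) [Field k] [PerfectField k] [Field L] [CharP L 2] [Algebra k L]
    (A : Subalgebra k L) (Q : Ideal A) (S : Subring L) [IsLocalRing S]
    (hA : A.FG) (hQ : Q.IsPrime) (hS : ∀ z : L, z ∈ S ↔ ∃ a b : A, b ∉ Q ∧ z = (a : L) / (b : L)) :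
    ∃ (r : ℕ) (b : Fin r → ResidueField S), TwoBasis.IsTwoBasis b := by
  haveI := hQ
  haveI : Algebra.FiniteType k A := (Subalgebra.fg_iff_finiteType A).mp hA
  haveI : CharP k 2 := (algebraMap k L).charP (algebraMap k L).injective 2
  haveI : Algebra.EssFiniteType k Q.ResidueField := Algebra.EssFiniteType.comp k A _
  have hfg : (⊤ : IntermediateField k Q.ResidueField).FG := IntermediateField.fg_top_iff.mpr inferInstance
  obtain ⟨r, lam, -, hB, -⟩ := TwoBasis.exists_twoBasis_dual_derivations k Q.ResidueField hfg
  obtain ⟨e⟩ := GeomChain.nonempty_residueField_ringEquiv A Q S hS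
  exact ⟨r, fun i => e.symm (lam i), isTwoBasis_map_ringEquiv e.symm hB⟩

/-- **hBhat — the residue field of the COMPLETION of a (Noetherian) geometric chart carries a finite 2-basis with DUAL `ℤ`-derivations** (K1′'s frame
shape up to `pAdjoin_eq_top_of_isTwoBasis`). [cite: Matsumura1987, Thm. 26.5] -/
theorem exists_pFrame_completion_of_chart (k L : Type) [Field k] [PerfectField k] [Field L] [CharP L 2] [Algebra k L]
    (A : Subalgebra k L) (Q : Ideal A) (S : Subring L) [IsLocalRing S] [IsNoetherianRing S]
    (hA : A.FG) (hQ : Q.IsPrime) (hS : ∀ z : L, z ∈ S ↔ ∃ a b : A, b ∉ Q ∧ z = (a : L) / (b : L)) :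
    ∃ (r : ℕ) (γ : Fin r → ResidueField (AdicCompletion (maximalIdeal S) S))
      (D : Fin r → Derivation ℤ (ResidueField (AdicCompletion (maximalIdeal S) S)) (ResidueField (AdicCompletion (maximalIdeal S) S))),
      TwoBasis.IsTwoBasis γ ∧ ∀ l l', D l (γ l') = if l' = l then 1 else 0 := by
  haveI := hQ
  haveI : Algebra.FiniteType k A := (Subalgebra.fg_iff_finiteType A).mp hA
  haveI : CharP k 2 := (algebraMap k L).charP (algebraMap k L).injective 2
  haveI : Algebra.EssFiniteType k Q.ResidueField := Algebra.EssFiniteType.comp k A _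
  have hfg : (⊤ : IntermediateField k Q.ResidueField).FG := IntermediateField.fg_top_iff.mpr inferInstance
  obtain ⟨r, lam, D, hB, hD⟩ := TwoBasis.exists_twoBasis_dual_derivations k Q.ResidueField hfg
  obtain ⟨e⟩ := GeomChain.nonempty_residueField_ringEquiv A Q S hS
  let e₁ : ResidueField S ≃+* ResidueField (AdicCompletion (maximalIdeal S) S) :=
    RingEquiv.ofBijective _ (AdicCompletion.residueField_map_bijective S)
  let E : Q.ResidueField ≃+* ResidueField (AdicCompletion (maximalIdeal S) S) := e.symm.trans e₁
  have hD' := fun l => exists_derivation_map_ringEquiv E (D l)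
  choose D' hD' using hD'
  refine ⟨r, fun i => E (lam i), D', isTwoBasis_map_ringEquiv E hB, fun l l' => ?_⟩
  change D' l (E (lam l')) = _
  rw [hD', hD l l']
  split_ifs with h1 h2 h2
  · rw [map_one]
  · exact absurd h1.symm h2
  · exact absurd h2.symm h1
  · rw [map_zero]

end Summit.ResolutionOfSingularities.ResolutionOfSingularities.Theorems.SwitchingDichotomy.GeomTwoBasis

end
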